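import Literature.Analysis.SegalBargmann.SchwartzChirpDerivative
import HarnessLib

/-!
# A weak product rule for the Siegel chirp group

The chirp one-parameter groups `y ↦ chirpL2 (y • b)` of `L²(ℝ^σ)` (tree `SchwartzMetaplecticGenerators`) are
unitary but not norm-differentiable; by `SchwartzChirpDerivative` every Schwartz vector is a `C¹`-vector with the
explicit generator `chirpGen b = -πi (x·bx)`.  This file supplies the calculus needed to differentiate matrix
coefficients of PRODUCTS of such groups:

* §1 `hasDerivAt_apply_of_norm_le` — abstract lemma: if `U y` are contractions of a normed space, `v` is a path
  differentiable at `0`, `y ↦ U y (v 0)` is differentiable at `0` and `U y v'(0) → v'(0)`, then `y ↦ U y (v y)` is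
  differentiable at `0` with derivative `(d/dy U y (v 0)) + v'(0)` (an `ε/3` argument; no uniform differentiability);
* §2 `hasDerivAt_chirpL2_apply` — the chirp instance: `θ ↦ chirpL2 ((s θ) • b) (v θ)` with `s 0 = 0`, `v 0 = toL2 h`
  has derivative `s'(0) • toL2 (chirpGen b h) + v'(0)`;
* §3 continuity helpers (`tendsto_chirpL2_smul_toL2`) and the skew-symmetry of the generator
  `⟪toL2 (chirpGen b f), toL2 f'⟫ = -⟪toL2 f, toL2 (chirpGen b f')⟫`;
* §4 `hasDerivAt_inner_chirp_triple` — the three-factor matrix coefficient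
  `θ ↦ ⟪W M(t θ) g, M(s θ) W M(-t θ) g⟫` (with `W` a unitary of `L²` carrying `toL2 g ↦ toL2 h`,
  `toL2 (chirpGen b g) ↦ toL2 h₁`) is differentiable at `0` with derivative
  `s' ⟪h, X h⟫ - t' ⟪h, h₁⟫ + t' ⟪h₁, h⟫`.

This is the analytic step of the zero-point computation along an `SU(1,1)`-circle factorised as
`u₋(t θ) u₊(s θ) u₋(t θ)` (theta lane design note `W2inf-zp-design.md` §5): all moments are real Gaussian moments, no
Fresnel integrals or Weil indices occur.

References (provenance only; nothing of print is asserted): Folland 1989, *Harmonic Analysis in Phase Space*,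
Ch. 4 §2 (4.24)–(4.25), Prop. 4.27 (the infinitesimal metaplectic representation); Reed–Simon I §VIII.4.
-/

noncomputable section

open MeasureTheory Complex Filter Topology
open scoped InnerProductSpace ComplexConjugate

namespace Literature.Analysis.SegalBargmann

/-- `L²(ℝ^σ)` for Lebesgue measure. -/
local notation "L2R" σ:max => (Lp ℂ 2 (volume : Measure (σ → ℝ)))
/-- Folland's Schwartz space on the sup-norm carrier. -/
local notation "SR" σ:max => (SchwartzMap (σ → ℝ) ℂ)

/-! ## 1. Abstract product rule for a family of contractions applied to a differentiable path -/

/-- **Product rule, strong form.** Let `U y` be linear contractions of a real normed space `H`, `v : ℝ → H`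
differentiable at `0` with derivative `v'`, suppose the orbit `y ↦ U y (v 0)` is differentiable at `0` with
derivative `x'`, and `U y v' → v'` as `y → 0`.  Then `y ↦ U y (v y)` is differentiable at `0` with derivative
`x' + v'`.  (Standard `ε/3`-argument for `C¹`-vectors of contraction families.) [folklore] -/
theorem hasDerivAt_apply_of_norm_le {H : Type*} [NormedAddCommGroup H] [NormedSpace ℝ H]
    {U : ℝ → H →ₗ[ℝ] H} (hU : ∀ y z, ‖U y z‖ ≤ ‖z‖) {v : ℝ → H} {v' x' : H}
    (hv : HasDerivAt v v' 0) (hx : HasDerivAt (fun y => U y (v 0)) x' 0)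
    (hc : Tendsto (fun y => U y v') (𝓝 0) (𝓝 v')) :
    HasDerivAt (fun y => U y (v y)) (x' + v') 0 := by
  rw [hasDerivAt_iff_isLittleO] at hv hx ⊢
  simp only [sub_zero] at hv hx ⊢
  rw [Asymptotics.isLittleO_iff] at hv hx ⊢
  intro ε hε
  have hε3 : 0 < ε / 3 := by positivity
  have hc' : ∀ᶠ y in 𝓝 (0 : ℝ), ‖U y v' - v'‖ ≤ ε / 3 := by
    filter_upwards [Metric.tendsto_nhds.1 hc (ε / 3) hε3] with y hy
    rw [dist_eq_norm] at hy
    exact hy.le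
  filter_upwards [hv hε3, hx hε3, hc'] with y hvy hxy hcy
  have hdec : U y (v y) - U 0 (v 0) - y • (x' + v') =
      U y (v y - v 0 - y • v') + (U y (v 0) - U 0 (v 0) - y • x') + y • (U y v' - v') := by
    simp only [map_sub, LinearMap.map_smul, smul_add, smul_sub]
    abel
  rw [hdec]
  calc ‖U y (v y - v 0 - y • v') + (U y (v 0) - U 0 (v 0) - y • x') + y • (U y v' - v')‖
      ≤ ‖U y (v y - v 0 - y • v')‖ + ‖U y (v 0) - U 0 (v 0) - y • x'‖ + ‖y • (U y v' - v')‖ :=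
        norm_add₃_le
    _ ≤ ε / 3 * ‖y‖ + ε / 3 * ‖y‖ + ‖y‖ * (ε / 3) := by
        refine add_le_add (add_le_add ((hU y _).trans hvy) hxy) ?_
        rw [norm_smul]
        exact mul_le_mul_of_nonneg_left hcy (norm_nonneg _)
    _ = ε * ‖y‖ := by ring

/-! ## 2. The chirp instance -/

variable {σ : Type*} [Fintype σ] [DecidableEq σ]

omit [DecidableEq σ] in
/-- The unitary chirp `chirpL2 c` as a real-linear map of `L²(ℝ^σ)` (for real-variable calculus). [folklore] -/
def chirpL2Real (c : (σ → ℝ) →ₗ[ℝ] (σ → ℝ)) : (L2R σ) →ₗ[ℝ] L2R σ :=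
  ((chirpL2 c).toLinearEquiv : (L2R σ) →ₗ[ℂ] L2R σ).restrictScalars ℝ

omit [DecidableEq σ] in
/-- `chirpL2Real c z = chirpL2 c z`. [folklore] -/
@[simp] theorem chirpL2Real_apply (c : (σ → ℝ) →ₗ[ℝ] (σ → ℝ)) (z : L2R σ) :
    chirpL2Real c z = chirpL2 c z := rfl

omit [DecidableEq σ] in
/-- `chirpL2 0` fixes every `toL2 f`. [folklore] -/
theorem chirpL2_zero_toL2 (f : SR σ) :
    (chirpL2 (0 : (σ → ℝ) →ₗ[ℝ] (σ → ℝ)) (toL2 f) : L2R σ) = toL2 f := by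
  rw [← toL2_chirpS, chirpS_zero, ContinuousLinearMap.id_apply]

omit [DecidableEq σ] in
/-- **Product rule for chirps**: for `s : ℝ → ℝ` with `s 0 = 0`, `s'(0) = s'`, and a path `v` in `L²(ℝ^σ)`
differentiable at `0` through a Schwartz vector `v 0 = toL2 h` whose derivative `v'` is moved continuously by the
chirp group, `θ ↦ chirpL2 ((s θ) • b) (v θ)` is differentiable at `0` with derivative `s' • toL2 (chirpGen b h) + v'`.
[cite: Folland1989, Ch. 4 §2 (4.25)] -/
theorem hasDerivAt_chirpL2_apply (b : (σ → ℝ) →ₗ[ℝ] (σ → ℝ)) {s : ℝ → ℝ} {s' : ℝ}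
    (hs : HasDerivAt s s' 0) (hs0 : s 0 = 0) {v : ℝ → L2R σ} {v' : L2R σ} (hv : HasDerivAt v v' 0)
    {h : SR σ} (hv0 : v 0 = toL2 h)
    (hc : Tendsto (fun y : ℝ => (chirpL2 (y • b) v' : L2R σ)) (𝓝 0) (𝓝 v')) :
    HasDerivAt (fun θ : ℝ => (chirpL2 ((s θ) • b) (v θ) : L2R σ)) (s' • toL2 (chirpGen b h) + v') 0 := by
  have hU : ∀ (y : ℝ) (z : L2R σ), ‖chirpL2Real ((s y) • b) z‖ ≤ ‖z‖ := fun y z => by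
    rw [chirpL2Real_apply, LinearIsometryEquiv.norm_map]
  have hx : HasDerivAt (fun y : ℝ => chirpL2Real ((s y) • b) (v 0)) (s' • toL2 (chirpGen b h)) 0 := by
    have h1 : HasDerivAt (fun y : ℝ => toL2 (chirpS (y • b) h)) (toL2 (chirpGen b h)) (s 0) := by
      rw [hs0]
      exact hasDerivAt_toL2_chirpS_zero b h
    refine (h1.scomp 0 hs).congr_of_eventuallyEq (Filter.Eventually.of_forall fun y => ?_)
    show chirpL2Real (s y • b) (v 0) = toL2 (chirpS (s y • b) h)
    rw [chirpL2Real_apply, hv0, toL2_chirpS]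
  have hs_t : Tendsto s (𝓝 0) (𝓝 0) := by
    simpa only [hs0] using hs.continuousAt.tendsto
  have hc' : Tendsto (fun y : ℝ => chirpL2Real ((s y) • b) v') (𝓝 0) (𝓝 v') := by
    simpa only [chirpL2Real_apply, Function.comp_def] using hc.comp hs_t
  simpa only [chirpL2Real_apply] using hasDerivAt_apply_of_norm_le hU hv hx hc'

/-! ## 3. Continuity helpers and skew-symmetry of the generator -/

omit [DecidableEq σ] in
/-- The chirp group is strongly continuous at `0` on complex multiples of Schwartz vectors. [folklore] -/
theorem tendsto_chirpL2_smul_toL2 (b : (σ → ℝ) →ₗ[ℝ] (σ → ℝ)) (c : ℂ) (f : SR σ) :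
    Tendsto (fun y : ℝ => (chirpL2 (y • b) (c • toL2 f) : L2R σ)) (𝓝 0) (𝓝 (c • toL2 f)) := by
  have h1 : (fun y : ℝ => (chirpL2 (y • b) (c • toL2 f) : L2R σ)) = fun y => c • toL2 (chirpS (y • b) f) := by
    funext y
    rw [LinearIsometryEquiv.map_smul, toL2_chirpS]
  rw [h1]
  have h2 : Tendsto (fun y : ℝ => c • toL2 (chirpS (y • b) f)) (𝓝 0)
      (𝓝 (c • toL2 (chirpS ((0 : ℝ) • b) f))) :=
    ((continuous_toL2_chirpS b f).tendsto 0).const_smul c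
  rwa [zero_smul, chirpS_zero, ContinuousLinearMap.id_apply] at h2

omit [DecidableEq σ] in
/-- Real multiples: `r • toL2 f = (r : ℂ) • toL2 f` in `L²`. [folklore] -/
theorem real_smul_toL2 (r : ℝ) (z : L2R σ) : r • z = (r : ℂ) • z :=
  RCLike.real_smul_eq_coe_smul (K := ℂ) r z

omit [DecidableEq σ] in
/-- **Skew-symmetry of the chirp generator** on Schwartz vectors:
`⟪X_b f, f'⟫ = -⟪f, X_b f'⟫` (`X_b` is multiplication by the purely imaginary function `-πi x·bx`).
[cite: Folland1989, Ch. 4 §2 (4.25)] -/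
theorem inner_toL2_chirpGen_left (b : (σ → ℝ) →ₗ[ℝ] (σ → ℝ)) (f f' : SR σ) :
    ⟪(toL2 (chirpGen b f) : L2R σ), toL2 f'⟫_ℂ = -⟪(toL2 f : L2R σ), toL2 (chirpGen b f')⟫_ℂ := by
  rw [MeasureTheory.L2.inner_def, MeasureTheory.L2.inner_def, ← integral_neg]
  refine integral_congr_ae ?_
  filter_upwards [coeFn_toL2 (chirpGen b f), coeFn_toL2 f', coeFn_toL2 f, coeFn_toL2 (chirpGen b f')]
    with x h1 h2 h3 h4
  rw [h1, h2, h3, h4, chirpGen_apply, chirpGen_apply]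
  simp only [RCLike.inner_apply, map_mul, Complex.conj_ofReal, Complex.conj_I]
  ring

/-! ## 4. The three-factor matrix coefficient -/

omit [DecidableEq σ] in
/-- A unitary `W` of `L²(ℝ^σ)` as a real-linear continuous map (for the chain rule). [folklore] -/
theorem exists_clm_real_eq (W : (L2R σ) ≃ₗᵢ[ℂ] L2R σ) :
    ∃ Wr : (L2R σ) →L[ℝ] L2R σ, ∀ z, Wr z = W z :=
  ⟨((W.toContinuousLinearEquiv : (L2R σ) ≃L[ℂ] L2R σ) : (L2R σ) →L[ℂ] L2R σ).restrictScalars ℝ, fun _ => rfl⟩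

omit [DecidableEq σ] in
/-- Chain rule through a unitary: `θ ↦ W (toL2 (chirpS ((t θ) • b) g))` has derivative `(t' : ℂ) • W (toL2 (X_b g))`
at `0` when `t 0 = 0`, `t'(0) = t'`. [cite: Folland1989, Ch. 4 §2 (4.25)] -/
theorem hasDerivAt_unitary_toL2_chirpS (b : (σ → ℝ) →ₗ[ℝ] (σ → ℝ)) (W : (L2R σ) ≃ₗᵢ[ℂ] L2R σ) (g : SR σ)
    {t : ℝ → ℝ} {t' : ℝ} (ht : HasDerivAt t t' 0) (ht0 : t 0 = 0) :
    HasDerivAt (fun θ : ℝ => (W (toL2 (chirpS ((t θ) • b) g)) : L2R σ))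
      ((t' : ℂ) • W (toL2 (chirpGen b g))) 0 := by
  obtain ⟨Wr, hWr⟩ := exists_clm_real_eq W
  have h1 : HasDerivAt (fun y : ℝ => toL2 (chirpS (y • b) g)) (toL2 (chirpGen b g)) (t 0) := by
    rw [ht0]
    exact hasDerivAt_toL2_chirpS_zero b g
  have h2 : HasDerivAt (fun θ : ℝ => (toL2 (chirpS ((t θ) • b) g) : L2R σ)) (t' • toL2 (chirpGen b g)) 0 :=
    h1.scomp 0 ht
  have h3 := Wr.hasFDerivAt.comp_hasDerivAt 0 h2
  have h4 : Wr (t' • toL2 (chirpGen b g)) = (t' : ℂ) • W (toL2 (chirpGen b g)) := by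
    rw [hWr, real_smul_toL2, LinearIsometryEquiv.map_smul]
  rw [h4] at h3
  refine h3.congr_of_eventuallyEq (Filter.Eventually.of_forall fun θ => ?_)
  rw [Function.comp_apply, hWr]

omit [DecidableEq σ] in
/-- **Three-factor weak product rule.**  Let `W` be a unitary of `L²(ℝ^σ)` with `W (toL2 g) = toL2 h` and
`W (toL2 (X_b g)) = toL2 h₁` (`g, h, h₁` Schwartz), and `s, t : ℝ → ℝ` differentiable at `0` with
`s 0 = t 0 = 0`.  Then the matrix coefficient
`φ(θ) = ⟪W M(t θ) g, M(s θ) W M(-t θ) g⟫` (with `M(y) = chirpL2 (y • b)`)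
is differentiable at `0` with `φ'(0) = s' ⟪h, X_b h⟫ - t' ⟪h, h₁⟫ + t' ⟪h₁, h⟫`.
[cite: Folland1989, Ch. 4 §2 (4.25), Prop. 4.27] -/
theorem hasDerivAt_inner_chirp_triple (b : (σ → ℝ) →ₗ[ℝ] (σ → ℝ)) (W : (L2R σ) ≃ₗᵢ[ℂ] L2R σ)
    (g h h₁ : SR σ) (hWg : W (toL2 g) = toL2 h) (hWXg : W (toL2 (chirpGen b g)) = toL2 h₁)
    {s t : ℝ → ℝ} {s' t' : ℝ} (hs : HasDerivAt s s' 0) (hs0 : s 0 = 0) (ht : HasDerivAt t t' 0)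
    (ht0 : t 0 = 0) :
    HasDerivAt (fun θ : ℝ => ⟪(W (toL2 (chirpS ((t θ) • b) g)) : L2R σ),
        chirpL2 ((s θ) • b) (W (toL2 (chirpS ((-t θ) • b) g)))⟫_ℂ)
      ((s' : ℂ) * ⟪(toL2 h : L2R σ), toL2 (chirpGen b h)⟫_ℂ - (t' : ℂ) * ⟪(toL2 h : L2R σ), toL2 h₁⟫_ℂ +
        (t' : ℂ) * ⟪(toL2 h₁ : L2R σ), toL2 h⟫_ℂ) 0 := by
  -- the left factor `G θ = W M(t θ) g`
  have hG : HasDerivAt (fun θ : ℝ => (W (toL2 (chirpS ((t θ) • b) g)) : L2R σ)) ((t' : ℂ) • toL2 h₁) 0 := by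
    have := hasDerivAt_unitary_toL2_chirpS b W g ht ht0
    rwa [hWXg] at this
  -- the inner path `F θ = W M(-t θ) g`
  have hF : HasDerivAt (fun θ : ℝ => (W (toL2 (chirpS ((-t θ) • b) g)) : L2R σ)) (((-t' : ℝ) : ℂ) • toL2 h₁) 0 := by
    have htn : HasDerivAt (fun x : ℝ => -t x) (-t') 0 := ht.neg
    have := hasDerivAt_unitary_toL2_chirpS b W g htn (by rw [ht0, neg_zero])
    rw [hWXg] at this
    exact this
  have hF0 : (fun θ : ℝ => (W (toL2 (chirpS ((-t θ) • b) g)) : L2R σ)) 0 = toL2 h := by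
    simp only [ht0, neg_zero, zero_smul, chirpS_zero, ContinuousLinearMap.id_apply, hWg]
  -- the middle factor applied to the inner path
  have hM : HasDerivAt (fun θ : ℝ => (chirpL2 ((s θ) • b) (W (toL2 (chirpS ((-t θ) • b) g))) : L2R σ))
      (s' • toL2 (chirpGen b h) + ((-t' : ℝ) : ℂ) • toL2 h₁) 0 :=
    hasDerivAt_chirpL2_apply b hs hs0 hF hF0 (tendsto_chirpL2_smul_toL2 b _ h₁)
  -- differentiate the inner product
  have hφ := hG.inner ℂ hM
  refine hφ.congr_deriv ?_
  have hG0 : (W (toL2 (chirpS ((t 0) • b) g)) : L2R σ) = toL2 h := by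
    rw [ht0, zero_smul, chirpS_zero, ContinuousLinearMap.id_apply, hWg]
  have hM0 : (chirpL2 ((s 0) • b) (W (toL2 (chirpS ((-t 0) • b) g))) : L2R σ) = toL2 h := by
    rw [hs0, ht0, neg_zero, zero_smul, chirpS_zero, ContinuousLinearMap.id_apply, hWg, chirpL2_zero_toL2]
  rw [hG0, hM0, inner_add_right, real_smul_toL2, inner_smul_right, inner_smul_right, inner_smul_left,
    Complex.conj_ofReal]
  push_cast
  ring

end Literature.Analysis.SegalBargmann
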